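import Summits.AtomisticToContinuum.BoseEinsteinCondensation.Theorems.BECCutLineWeakDisorderGroundStateRigidityStubCellInsertion
import HarnessLib

/-!
# Crux `GroundStateRigidity` (stmt-AtomisticToContinuum-9072), line `persistent_confinement`:
# the registered stub `stub_insertionBose` (Stub INS)

Supports (does not close) stmt-AtomisticToContinuum-9072; registered stub `stub_insertionBose`
(Stub INS of line `persistent_confinement`; lead c5). **The Bose-frame insertion window for every
finite-range `v ≥ 0`.** There is an absolute `C > 0` (here `C = 2000`) such that
`E₀(N+1, L) ≤ E₀(N, L) + C/ℓ²` whenever `v` is measurable and vanishes beyond `R₀ ≤ ℓ`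
(`0 < R₀`, anything — `⊤` included — below `R₀`), `0 < L`, and `C (N+1) ℓ³ ≤ L³`.

## Proof

Not by the cell/IMS construction of the line card but as a corollary of the tree's landed
chemical-potential bound for the crux `RigidMomentumBound`:
`RigidMomentumBound.InsertionBound.insertionBound_range_two` (range `2`, Dyson's Jastrow-dressed
insertion, LSSY2005 Thm 2.2) rescaled to the range `ℓ ≥ R₀` by the exact dilation covariance
`InsertionScaling.insertionBound_of_fixedRange`:
`E₀(N+1, L) ≤ E₀(N, L) + 120/L² + 13000·N·ℓ/L³` whenever `N ℓ³ ≤ L³/2000`, which follows from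
`2000 (N+1) ℓ³ ≤ L³` (this rescaled bound is the landed `CellInsertion.insertionBound_range` of the
sibling stub file `…StubCellInsertion.lean`). Moreover `L³ ≥ 2000 ℓ³ > (12ℓ)³` gives `L ≥ 12ℓ`, so `120/L² ≤ 1/ℓ²`, and
`13000 N ℓ/L³ ≤ 13000 N ℓ/(2000 (N+1) ℓ³) ≤ 7/ℓ²`; total `≤ 8/ℓ² ≤ 2000/ℓ²`.
-/

noncomputable section

open MeasureTheory Filter Metric
open scoped ENNReal NNReal Topology

namespace Summit.AtomisticToContinuum.BoseEinsteinCondensation.Theorems.GroundStateRigidity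

open Literature.MathematicalPhysics.QuantumManyBody.BoseGas

namespace InsertionBose

/-- The numerical step: for `0 < ℓ`, `0 < L` and `2000 (N+1) ℓ³ ≤ L³`,
`120/L² + 13000·N·ℓ/L³ ≤ 8/ℓ²` (`L ≥ 12 ℓ` as `12³ = 1728 ≤ 2000`). [folklore] -/
theorem numeric_bound {N : ℕ} {ℓ L : ℝ} (hℓ : 0 < ℓ) (hL : 0 < L)
    (hNL : 2000 * ((N : ℝ) + 1) * ℓ ^ 3 ≤ L ^ 3) :
    120 / L ^ 2 + 13000 * N * ℓ / L ^ 3 ≤ 8 / ℓ ^ 2 := by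
  have hN : (0 : ℝ) ≤ N := Nat.cast_nonneg N
  have hℓ2 : 0 < ℓ ^ 2 := by positivity
  have hℓ3 : 0 < ℓ ^ 3 := by positivity
  have hL3 : 0 < L ^ 3 := by positivity
  have h0 : (0 : ℝ) ≤ N * ℓ ^ 3 := by positivity
  -- `L ≥ 12 ℓ`
  have hcube : (12 * ℓ) ^ 3 ≤ L ^ 3 := by nlinarith
  have h12 : 12 * ℓ ≤ L := le_of_pow_le_pow_left₀ (by norm_num) hL.le hcube
  have hsq : 144 * ℓ ^ 2 ≤ L ^ 2 := by nlinarith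
  have hA : 120 / L ^ 2 ≤ 1 / ℓ ^ 2 := by
    rw [div_le_div_iff₀ (by positivity) hℓ2]
    nlinarith
  have hB : 13000 * N * ℓ / L ^ 3 ≤ 7 / ℓ ^ 2 := by
    rw [div_le_div_iff₀ hL3 hℓ2]
    calc 13000 * N * ℓ * ℓ ^ 2 = 13000 * (N * ℓ ^ 3) := by ring
      _ ≤ 7 * (2000 * ((N : ℝ) + 1) * ℓ ^ 3) := by nlinarith
      _ ≤ 7 * L ^ 3 := by gcongr
  calc 120 / L ^ 2 + 13000 * N * ℓ / L ^ 3 ≤ 1 / ℓ ^ 2 + 7 / ℓ ^ 2 := add_le_add hA hB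
    _ = 8 / ℓ ^ 2 := by ring

end InsertionBose

open InsertionBose in
/-- **Stub INS `stub_insertionBose` of the line `persistent_confinement` of the crux
`GroundStateRigidity` — the Bose-frame insertion window (every finite-range `v ≥ 0`).** There is an
absolute `C > 0` such that `E₀(N+1, L) ≤ E₀(N, L) + C/ℓ²` whenever `v` (measurable) vanishes beyond
`R₀ ≤ ℓ` and `C (N+1) ℓ³ ≤ L³` (`0 < R₀`, `0 < ℓ`, `0 < L`). With `C = 2000`: corollary of the tree's
chemical-potential bound `RigidMomentumBound.InsertionBound.insertionBound_range_two` (Dyson's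
Jastrow-dressed insertion) rescaled to the range `ℓ` by
`InsertionScaling.insertionBound_of_fixedRange`, and the arithmetic
`120/L² + 13000·N·ℓ/L³ ≤ 8/ℓ² ≤ 2000/ℓ²` under `2000 (N+1) ℓ³ ≤ L³`.
[cite: LSSY2005, Thm 2.2 (2.17)–(2.26)] -/
theorem stub_insertionBose :
    ∃ C : ℝ, 0 < C ∧ ∀ (N : ℕ) (L ℓ R₀ : ℝ) (v : ℝ → ℝ≥0∞), Measurable v → 0 < R₀ →
      (∀ r : ℝ, R₀ < r → v r = 0) → 0 < L → 0 < ℓ → R₀ ≤ ℓ → C * ((N : ℝ) + 1) * ℓ ^ 3 ≤ L ^ 3 →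
      groundStateEnergy v (N + 1) L ≤ groundStateEnergy v N L + ENNReal.ofReal (C / ℓ ^ 2) := by
  refine ⟨2000, by norm_num, fun N L ℓ R₀ v hv _ hvR hL hℓ hRℓ hNL => ?_⟩
  have hvℓ : ∀ r, ℓ < r → v r = 0 := fun r hr => hvR r (hRℓ.trans_lt hr)
  have hN : (0 : ℝ) ≤ N := Nat.cast_nonneg N
  have hℓ3 : 0 < ℓ ^ 3 := by positivity
  have hdens : (N : ℝ) * ℓ ^ 3 ≤ L ^ 3 / 2000 := by
    rw [le_div_iff₀ (by norm_num : (0 : ℝ) < 2000)]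
    nlinarith
  have h8 : (8 : ℝ) / ℓ ^ 2 ≤ 2000 / ℓ ^ 2 := by gcongr; norm_num
  exact (CellInsertion.insertionBound_range hv hℓ hvℓ N hL hdens).trans
    (add_le_add_right (ENNReal.ofReal_le_ofReal ((numeric_bound hℓ hL hNL).trans h8)) _)

end Summit.AtomisticToContinuum.BoseEinsteinCondensation.Theorems.GroundStateRigidity

end
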